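import Summits.HubbardSuperconductivity.HubbardSuperconductivity.Theses.FunctionFieldCertificate
import Summits.HubbardSuperconductivity.HubbardSuperconductivity.Theorems.FunctionFieldCertificateMesoscopicPairOrderInfraredWeight
import Summits.HubbardSuperconductivity.HubbardSuperconductivity.Theorems.FunctionFieldCertificateMesoscopicPairOrderBloch
import HarnessLib

/-!
# `MesoscopicPairOrder` (stmt-HubbardSuperconductivity-7331), line `pointwise_split`:
# budget-free forms of the load-bearing stub (B) `LeakBeatingBlockPairSeed`

Support file for the crux (route `FunctionFieldCertificate`, pole-free half; lead c6 of line
`pointwise_split`). Stub (B) of the line reads: at some `(U, δ)`, for EVERY background budget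
`S, A ≥ 0` there are one block scale `R₀ > 0`, a window radius `ε > 0` and a margin
`m₀ > 32 ε (S ε + A) + (S + A/ε)/R₀²` such that `m₀ R₀² ≤ T_{R₀}(ψ)/L²` for every normalised
`(N_L, S^z = 0)`-sector ground state `ψ` of every large even torus, where
`T_R(ψ) = Σ_{x,y} Πᵢ (1 - |(y - x)ᵢ|_L/R)₊ Re⟨P_x ψ, P_y ψ⟩`, `P_x = localPair dWaveFormFactor L x`.
The budget `(S, A, ε)` is bookkeeping inherited from the Goldstone profile of stub (A); this file
removes it and states exactly what (B) asks of the model: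

* `boxSum_nonneg` — `0 ≤ T_R(ψ)` for `0 < R`, `2R ≤ L` (momentum form
  `R² T_R = Σ_m |F_R(m)|² S_ψ(m)` with `S_ψ ≥ 0`).
* `leakBeatingBlockPairSeed_iff_superlinear` — **(B) ⟺ SUPER-LINEAR BLOCK PAIR ORDER**:
  `∃ (U, δ) ∀ C ∃ R₀ > 0 ∃ L₀ ∀ even L ≥ L₀ ∀ unit sector GS ψ : C · R₀ ≤ T_{R₀}(ψ)/L²`.
  (⇒: budget `S = 0`, `A = max C 0`; the leak is `≥ A/R₀` by `32ε + 1/(ε R₀²) ≥ 1/R₀`, so the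
  seed gives `T/L² ≥ m₀ R₀² ≥ A R₀`. ⇐: given `(S, A)` ask for `C = 12A + 3S + 1`, take
  `ε = 1/(4R₀)`, `m₀ = C/R₀`; the leak is `3S/R₀² + 12A/R₀ < C/R₀`.)
  So (B) says: the per-site Fejér block pair order `T_R(ψ)/L²` — which is `≈ m R²` under pair LRO
  with condensate density `m`, `O(1)` (the flat background) in a normal metal, and `≈ R^{2-η}` under
  algebraic pair quasi-order `|x|^{-η}` — is NOT `O(R)` along the scales, uniformly over sector
  ground states: it holds iff some `(U, δ)` has pair (quasi-)order with exponent `η < 1` at a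
  sequence of block scales, and fails for every state family with `η > 1` or no order. The split
  `(A) ∧ (B) ⇒ crux` (`mesoscopicPairOrder_of_subs`) cuts exactly at `η = 1`: the profile
  `S_ψ(q) ≤ S + A/|q|` of (A) excludes every `η < 1` short of a true condensate (`S_ψ(0) ~ L²`).
* `superlinear_iff_blochCorrelation` — the same statement needs BLOCH ground states only
  (`forall_ground_of_forall_bloch_ground`, p108106) and then reads on the pair correlation FUNCTION
  `C_ψ(z) = Re⟨P_0 ψ, P_z ψ⟩`: `∀ C ∃ R₀ > 0 … : C · R₀ ≤ Σ_z W_{R₀}(z) C_ψ(z)`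
  (`boxCorr_eq_card_mul_of_bloch`: `T_R(ψ) = L² Σ_z W_R(z) C_ψ(z)`), i.e. the Fejér box MEAN of
  the pair correlation function, `R₀⁻² Σ_z W_{R₀}(z) C_ψ(z)`, beats `C/R₀` for every `C` at some
  scale — the refuter's target form (exhibit, at each `(U, δ)`, one `C` and Bloch sector ground
  states with box mean `< C/R₀` at every scale).
* `leakBeatingBlockPairSeedIffSuperlinear` — registered one-line form.

Folklore finite-dimensional bookkeeping (Kennedy–Lieb–Shastry, PRL 61 (1988) 2582, for the block /
Parseval accounting; H. Tasaki, *Physics and Mathematics of Quantum Many-Body Systems* (2020) §4.1 for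
Bloch states). No definition is introduced.
-/

noncomputable section

-- the summit namespace repeats the problem name by design (D-0017)
set_option linter.dupNamespace false

namespace Summit.HubbardSuperconductivity.HubbardSuperconductivity.Theorems.FunctionFieldCertificate

open Matrix Finset Filter
open Literature.Probability.LatticeModels Literature.MathematicalPhysics.QuantumLattice
open Summit.HubbardSuperconductivity.HubbardSuperconductivity.Theses.FunctionFieldCertificate
open scoped ComplexOrder ComplexConjugate

section OneTorus

variable {L : ℕ} [NeZero L]

/-- **`T_R(ψ) ≥ 0`** for `0 < R`, `2R ≤ L`: by the momentum form
`R² T_R(ψ) = Σ_m |F_R(m)|² S_ψ(m)` (`sq_mul_boxSum_eq_sum_boxKernel_mul_pairStructureFactor`) with a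
nonnegative pair structure factor. [folklore] -/
theorem boxSum_nonneg (R : ℕ) (hR : 0 < R) (hRL : 2 * R ≤ L) (ψ : Fock (Orb (FermionTorus 2 L))) :
    0 ≤ ∑ x : TorusSite 2 L, ∑ y : TorusSite 2 L,
        (∏ i : Fin 2, max 0 (1 - |(((y i - x i).valMinAbs : ℤ) : ℝ)| / (R : ℝ))) *
          (star (localPair dWaveFormFactor L x *ᵥ ψ) ⬝ᵥ (localPair dWaveFormFactor L y *ᵥ ψ)).re := by
  have h := sq_mul_boxSum_eq_sum_boxKernel_mul_pairStructureFactor R hR hRL ψ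
  have hnn : 0 ≤ ∑ m : TorusSite 2 L,
      ‖∑ u : Fin 2 → Fin R, torusChar m (fun i => ((u i : ℕ) : ZMod L))‖ ^ 2 *
        pairStructureFactor dWaveFormFactor L ψ m :=
    Finset.sum_nonneg fun m _ => mul_nonneg (sq_nonneg _) (pairStructureFactor_nonneg _ _ _ _)
  have hR2 : (0 : ℝ) < (R : ℝ) ^ 2 := by positivity
  rw [← h] at hnn
  exact (mul_nonneg_iff_of_pos_left hR2).1 hnn

end OneTorus

/-- **(B) ⟺ SUPER-LINEAR BLOCK PAIR ORDER.** The load-bearing stub `LeakBeatingBlockPairSeed` of line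
`pointwise_split` (left) is equivalent to the budget-free statement (right): at some `U > 0`,
`δ ∈ (0, 1/2)`, for every constant `C` there are ONE block scale `R₀ > 0` and `L₀` such that every
normalised `(N_L, 0)`-sector ground state `ψ` of `hubbardTorus 2 L 1 U`, `L ≥ L₀` even, has
`C · R₀ ≤ T_{R₀}(ψ)/L²`. (⇒) budget `S = 0`, `A = max C 0`: the leak `32 ε A + A/(ε R₀²)` is at least
`A/R₀` (if `32 ε R₀ ≥ 1` the first term is, otherwise the second), so `T/L² ≥ m₀ R₀² ≥ A R₀ ≥ C R₀`.
(⇐) given `S, A ≥ 0` ask the right side for `C = 12A + 3S + 1` and put `ε = 1/(4R₀)`, `m₀ = C/R₀`: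
the leak equals `3S/R₀² + 12A/R₀ ≤ (3S + 12A)/R₀ < m₀`, and `m₀ R₀² = C R₀ ≤ T/L²`. [folklore] -/
theorem leakBeatingBlockPairSeed_iff_superlinear :
    (∃ U : ℝ, 0 < U ∧ ∃ δ ∈ Set.Ioo (0:ℝ) (1 / 2), ∀ S A : ℝ, 0 ≤ S → 0 ≤ A →
      ∃ (R₀ : ℕ) (ε m₀ : ℝ), 0 < R₀ ∧ 0 < ε ∧
        32 * ε * (S * ε + A) + (S + A / ε) / (R₀ : ℝ) ^ 2 < m₀ ∧
        ∃ L₀ : ℕ, ∀ (L : ℕ) [NeZero L], L₀ ≤ L → Even L →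
          ∀ ψ : Fock (Orb (FermionTorus 2 L)), star ψ ⬝ᵥ ψ = 1 →
            IsGroundStateInSector (hubbardTorus 2 L 1 U) (2 * ⌊(1 - δ) * (L : ℝ) ^ 2 / 2⌋₊) 0 ψ →
              m₀ * (R₀ : ℝ) ^ 2 ≤ (∑ x : Fin 2 → ZMod L, ∑ y : Fin 2 → ZMod L,
                (∏ i : Fin 2, max 0 (1 - |(((y i - x i).valMinAbs : ℤ) : ℝ)| / (R₀ : ℝ))) *
                  (star (Matrix.mulVec (localPair dWaveFormFactor L x) ψ) ⬝ᵥ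
                    Matrix.mulVec (localPair dWaveFormFactor L y) ψ).re) / (L : ℝ) ^ 2) ↔
    (∃ U : ℝ, 0 < U ∧ ∃ δ ∈ Set.Ioo (0:ℝ) (1 / 2), ∀ C : ℝ, ∃ R₀ : ℕ, 0 < R₀ ∧
        ∃ L₀ : ℕ, ∀ (L : ℕ) [NeZero L], L₀ ≤ L → Even L →
          ∀ ψ : Fock (Orb (FermionTorus 2 L)), star ψ ⬝ᵥ ψ = 1 →
            IsGroundStateInSector (hubbardTorus 2 L 1 U) (2 * ⌊(1 - δ) * (L : ℝ) ^ 2 / 2⌋₊) 0 ψ →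
              C * (R₀ : ℝ) ≤ (∑ x : TorusSite 2 L, ∑ y : TorusSite 2 L,
                (∏ i : Fin 2, max 0 (1 - |(((y i - x i).valMinAbs : ℤ) : ℝ)| / (R₀ : ℝ))) *
                  (star (localPair dWaveFormFactor L x *ᵥ ψ) ⬝ᵥ
                    (localPair dWaveFormFactor L y *ᵥ ψ)).re) / (L : ℝ) ^ 2) := by
  constructor
  · rintro ⟨U, hU, δ, hδ, hB⟩
    refine ⟨U, hU, δ, hδ, fun C => ?_⟩
    obtain ⟨R₀, ε, m₀, hR₀, hε, hleak, L₀, hseed⟩ := hB 0 (max C 0) le_rfl (le_max_right _ _)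
    refine ⟨R₀, hR₀, L₀, fun L _ hL hE ψ hψ hgs => ?_⟩
    have h := hseed L hL hE ψ hψ hgs
    have hRpos : (0 : ℝ) < R₀ := Nat.cast_pos.2 hR₀
    have hA : 0 ≤ max C 0 := le_max_right _ _
    -- the leak is at least `A / R₀`
    have hkey : max C 0 / (R₀ : ℝ) ≤ 32 * ε * (0 * ε + max C 0) + (0 + max C 0 / ε) / (R₀ : ℝ) ^ 2 := by
      have h2 : 0 ≤ (0 + max C 0 / ε) / (R₀ : ℝ) ^ 2 := by positivity
      have h3 : 0 ≤ 32 * ε * (0 * ε + max C 0) := by positivity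
      by_cases hc : 1 ≤ 32 * ε * (R₀ : ℝ)
      · have h1 : max C 0 / (R₀ : ℝ) ≤ 32 * ε * (0 * ε + max C 0) := by
          rw [div_le_iff₀ hRpos]
          nlinarith
        linarith
      · push Not at hc
        have h1 : max C 0 / (R₀ : ℝ) ≤ (0 + max C 0 / ε) / (R₀ : ℝ) ^ 2 := by
          have hεR : ε * (R₀ : ℝ) ≤ 1 := by nlinarith
          have hone : (1 : ℝ) ≤ 1 / (ε * (R₀ : ℝ)) := by
            rw [le_div_iff₀ (by positivity)]
            linarith
          have hq : 0 ≤ max C 0 / (R₀ : ℝ) := by positivity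
          calc max C 0 / (R₀ : ℝ) ≤ max C 0 / (R₀ : ℝ) * (1 / (ε * (R₀ : ℝ))) :=
                le_mul_of_one_le_right hq hone
            _ = (0 + max C 0 / ε) / (R₀ : ℝ) ^ 2 := by
                field_simp
                ring
        linarith
    have hm : max C 0 / (R₀ : ℝ) < m₀ := lt_of_le_of_lt hkey hleak
    have hm' : max C 0 * (R₀ : ℝ) ≤ m₀ * (R₀ : ℝ) ^ 2 := by
      have : max C 0 / (R₀ : ℝ) * (R₀ : ℝ) ^ 2 ≤ m₀ * (R₀ : ℝ) ^ 2 :=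
        mul_le_mul_of_nonneg_right hm.le (by positivity)
      calc max C 0 * (R₀ : ℝ) = max C 0 / (R₀ : ℝ) * (R₀ : ℝ) ^ 2 := by field_simp
        _ ≤ m₀ * (R₀ : ℝ) ^ 2 := this
    have hC : C * (R₀ : ℝ) ≤ max C 0 * (R₀ : ℝ) :=
      mul_le_mul_of_nonneg_right (le_max_left _ _) hRpos.le
    exact hC.trans (hm'.trans h)
  · rintro ⟨U, hU, δ, hδ, hS⟩
    refine ⟨U, hU, δ, hδ, fun S A hS0 hA0 => ?_⟩
    obtain ⟨R₀, hR₀, L₀, h⟩ := hS (12 * A + 3 * S + 1)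
    have hRpos : (0 : ℝ) < R₀ := Nat.cast_pos.2 hR₀
    have hR1 : (1 : ℝ) ≤ R₀ := by exact_mod_cast hR₀
    refine ⟨R₀, 1 / (4 * R₀), (12 * A + 3 * S + 1) / R₀, hR₀, by positivity, ?_, L₀, ?_⟩
    · -- the leak at `ε = 1/(4R₀)` is `3S/R₀² + 12A/R₀ < (12A + 3S + 1)/R₀`
      have e : 32 * (1 / (4 * (R₀ : ℝ))) * (S * (1 / (4 * (R₀ : ℝ))) + A) +
          (S + A / (1 / (4 * (R₀ : ℝ)))) / (R₀ : ℝ) ^ 2 =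
            3 * S / (R₀ : ℝ) ^ 2 + 12 * A / (R₀ : ℝ) := by
        field_simp
        ring
      rw [e]
      have h1 : 3 * S / (R₀ : ℝ) ^ 2 ≤ 3 * S / (R₀ : ℝ) := by
        apply div_le_div_of_nonneg_left (by positivity) hRpos
        nlinarith
      have h2 : 3 * S / (R₀ : ℝ) + 12 * A / (R₀ : ℝ) < (12 * A + 3 * S + 1) / (R₀ : ℝ) := by
        rw [← add_div, div_lt_div_iff_of_pos_right hRpos]
        linarith
      linarith
    · intro L _ hL hE ψ hψ hgs
      have h' := h L hL hE ψ hψ hgs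
      have e : (12 * A + 3 * S + 1) / (R₀ : ℝ) * (R₀ : ℝ) ^ 2 = (12 * A + 3 * S + 1) * (R₀ : ℝ) := by
        field_simp
      rw [e]
      exact h'

/-- **Bloch / correlation-function form.** The super-linear block pair order statement (left) is
equivalent to its restriction to BLOCH ground states — normalised sector ground states that are
eigenvectors of every lattice translation `fockTranslate v` — where the box functional is `L²` times
the Fejér box sum of the pair correlation function `C_ψ(z) = Re⟨P_0 ψ, P_z ψ⟩`
(`boxCorr_eq_card_mul_of_bloch`), so that the `L²` cancels: `∀ C ∃ R₀ > 0 ∃ L₀ ∀ even L ≥ L₀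
∀ unit Bloch sector GS ψ : C · R₀ ≤ Σ_z W_{R₀}(z) C_ψ(z)`. (⇐) is the every-ground-state reduction
`forall_ground_of_forall_bloch_ground` (the minimum of `T_R` over the ground eigenspace is attained
at a joint translation eigenvector). Tasaki (2020) §2.1, §4.1. [folklore] -/
theorem superlinear_iff_blochCorrelation :
    (∃ U : ℝ, 0 < U ∧ ∃ δ ∈ Set.Ioo (0:ℝ) (1 / 2), ∀ C : ℝ, ∃ R₀ : ℕ, 0 < R₀ ∧
        ∃ L₀ : ℕ, ∀ (L : ℕ) [NeZero L], L₀ ≤ L → Even L →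
          ∀ ψ : Fock (Orb (FermionTorus 2 L)), star ψ ⬝ᵥ ψ = 1 →
            IsGroundStateInSector (hubbardTorus 2 L 1 U) (2 * ⌊(1 - δ) * (L : ℝ) ^ 2 / 2⌋₊) 0 ψ →
              C * (R₀ : ℝ) ≤ (∑ x : TorusSite 2 L, ∑ y : TorusSite 2 L,
                (∏ i : Fin 2, max 0 (1 - |(((y i - x i).valMinAbs : ℤ) : ℝ)| / (R₀ : ℝ))) *
                  (star (localPair dWaveFormFactor L x *ᵥ ψ) ⬝ᵥ
                    (localPair dWaveFormFactor L y *ᵥ ψ)).re) / (L : ℝ) ^ 2) ↔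
    (∃ U : ℝ, 0 < U ∧ ∃ δ ∈ Set.Ioo (0:ℝ) (1 / 2), ∀ C : ℝ, ∃ R₀ : ℕ, 0 < R₀ ∧
        ∃ L₀ : ℕ, ∀ (L : ℕ) [NeZero L], L₀ ≤ L → Even L →
          ∀ ψ : Fock (Orb (FermionTorus 2 L)), star ψ ⬝ᵥ ψ = 1 →
            IsGroundStateInSector (hubbardTorus 2 L 1 U) (2 * ⌊(1 - δ) * (L : ℝ) ^ 2 / 2⌋₊) 0 ψ →
              (∀ v : TorusSite 2 L, ∃ c : ℂ, (fockTranslate v).val *ᵥ ψ = c • ψ) →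
                C * (R₀ : ℝ) ≤ ∑ z : TorusSite 2 L,
                  (∏ i : Fin 2, max 0 (1 - |(((z i - (0 : TorusSite 2 L) i).valMinAbs : ℤ) : ℝ)| /
                    (R₀ : ℝ))) *
                    (star (localPair dWaveFormFactor L 0 *ᵥ ψ) ⬝ᵥ
                      (localPair dWaveFormFactor L z *ᵥ ψ)).re) := by
  constructor
  · rintro ⟨U, hU, δ, hδ, hS⟩
    refine ⟨U, hU, δ, hδ, fun C => ?_⟩
    obtain ⟨R₀, hR₀, L₀, h⟩ := hS C
    refine ⟨R₀, hR₀, L₀, fun L _ hL hE ψ hψ hgs hbl => ?_⟩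
    have h' := h L hL hE ψ hψ hgs
    have hLpos : (0 : ℝ) < L := Nat.cast_pos.2 (Nat.pos_of_ne_zero (NeZero.ne L))
    have hL2 : (0 : ℝ) < (L : ℝ) ^ 2 := by positivity
    rw [boxCorr_eq_card_mul_of_bloch dWaveFormFactor R₀ hbl] at h'
    have e : ∀ t : ℝ, (L : ℝ) ^ 2 * t / (L : ℝ) ^ 2 = t := fun t => by field_simp
    rwa [e] at h'
  · rintro ⟨U, hU, δ, hδ, hS⟩
    refine ⟨U, hU, δ, hδ, fun C => ?_⟩
    obtain ⟨R₀, hR₀, L₀, h⟩ := hS C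
    refine ⟨R₀, hR₀, L₀, fun L _ hL hE ψ hψ hgs => ?_⟩
    have hLpos : (0 : ℝ) < L := Nat.cast_pos.2 (Nat.pos_of_ne_zero (NeZero.ne L))
    have hL2 : (0 : ℝ) < (L : ℝ) ^ 2 := by positivity
    rw [le_div_iff₀ hL2]
    refine forall_ground_of_forall_bloch_ground L 1 U _ 0 R₀ (C * (R₀ : ℝ) * (L : ℝ) ^ 2) ?_ ψ hψ hgs
    intro φ hφ hφgs hbl
    rw [boxCorr_eq_card_mul_of_bloch dWaveFormFactor R₀ hbl]
    have h' := h L hL hE φ hφ hφgs hbl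
    calc C * (R₀ : ℝ) * (L : ℝ) ^ 2 = (L : ℝ) ^ 2 * (C * (R₀ : ℝ)) := by ring
      _ ≤ _ := mul_le_mul_of_nonneg_left h' hL2.le

/-- **Registered form** (`leakBeatingBlockPairSeedIffSuperlinear`, stub of stmt-7331): stub (B) of line
`pointwise_split` ⟺ super-linear block pair order, one-line verbatim signature. [folklore] -/
theorem leakBeatingBlockPairSeedIffSuperlinear : (∃ U : ℝ, 0 < U ∧ ∃ δ ∈ Set.Ioo (0:ℝ) (1 / 2), ∀ S A : ℝ, 0 ≤ S → 0 ≤ A → ∃ (R₀ : ℕ) (ε m₀ : ℝ), 0 < R₀ ∧ 0 < ε ∧ 32 * ε * (S * ε + A) + (S + A / ε) / (R₀ : ℝ) ^ 2 < m₀ ∧ ∃ L₀ : ℕ, ∀ (L : ℕ) [NeZero L], L₀ ≤ L → Even L → ∀ ψ : Fock (Orb (FermionTorus 2 L)), star ψ ⬝ᵥ ψ = 1 → IsGroundStateInSector (hubbardTorus 2 L 1 U) (2 * ⌊(1 - δ) * (L : ℝ) ^ 2 / 2⌋₊) 0 ψ → m₀ * (R₀ : ℝ) ^ 2 ≤ (∑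 x : Fin 2 → ZMod L, ∑ y : Fin 2 → ZMod L, (∏ i : Fin 2, max 0 (1 - |(((y i - x i).valMinAbs : ℤ) : ℝ)| / (R₀ : ℝ))) * (star (Matrix.mulVec (localPair dWaveFormFactor L x) ψ) ⬝ᵥ Matrix.mulVec (localPair dWaveFormFactor L y) ψ).re) / (L : ℝ) ^ 2) ↔ (∃ U : ℝ, 0 < U ∧ ∃ δ ∈ Set.Ioo (0:ℝ) (1 / 2), ∀ C : ℝ, ∃ R₀ : ℕ, 0 < R₀ ∧ ∃ L₀ : ℕ, ∀ (L : ℕ) [NeZero L], L₀ ≤ L → Even L → ∀ ψ : Fock (Orb (FermionTorus 2 L)), star ψ ⬝ᵥ ψ = 1 → IsGroundStateInSector (hubbardTorus 2 L 1 U) (2 * ⌊(1 - δ) * (L : ℝ) ^ 2 / 2⌋₊) 0 ψ → C * (R₀ : ℝ) ≤ (∑ x : TorusSite 2 L, ∑ y : TorusSite 2 L, (∏ i : Fin 2, max 0 (1 - |(((y i - x i).valMinAbs : ℤ) : ℝ)| / (R₀ : ℝ))) * (star (localPair dWaveFormFactor L x *ᵥ ψ) ⬝ᵥ (localPair dWaveFormFactor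 L y *ᵥ ψ)).re) / (L : ℝ) ^ 2) :=
  leakBeatingBlockPairSeed_iff_superlinear

end Summit.HubbardSuperconductivity.HubbardSuperconductivity.Theorems.FunctionFieldCertificate
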